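import Literature.Computability.QuantumComplexity.PathModelRepresentation
import HarnessLib

/-!
# The AJL path-model generators satisfy the Temperley–Lieb relations

Topic `Literature/Computability/QuantumComplexity`; sibling proof file of
`PathModelRepresentation.lean`, which defines the Aharonov–Jones–Landau path-model generators
`Φ_i = ajlPhi k n i` on `n`-bit strings (AJL §3.1, eq. (3.1)) and proves two of the conjuncts of
AJL Claim 3.1 (`Φ_iᵀ = Φ_i`, `Φ_i² = d Φ_i`). This file proves the remaining conjuncts of
**Claim 3.1** (D. Aharonov, V. Jones, Z. Landau, *A polynomial quantum algorithm for approximating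
the Jones polynomial*, Algorithmica 55 (2009) = arXiv:quant-ph/0511096, §3.1, with §2.12 Claim 2.4:
"the `Φ_i` satisfy the Temperley–Lieb relations"), for every `k` and `n` and with the tree's zero
extension of `Φ_i` off the walks `P_{n,k}`:

* `ajlPhi_mul_succ_mul : Φ_i Φ_{i+1} Φ_i = Φ_i`,
* `ajlPhi_succ_mul_mul_succ : Φ_{i+1} Φ_i Φ_{i+1} = Φ_{i+1}`,
* `ajlPhi_mul_comm_of_le : Φ_i Φ_j = Φ_j Φ_i` for `j ≥ i + 2`,

together with the column description of `Φ_i` they rest on (`col_ajlPhi`: on a walk `p` reading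
`a, ¬a` at bits `i, i+1`, with `z` the vertex before bit `i`,
`Φ_i e_p = (λ_{z+ε(a)}/λ_z) e_p + (√(λ_{z+1}λ_{z-1})/λ_z) e_{p♭}`, `p♭` the flipped walk; all
other columns vanish) and the complex-matrix forms (`ajlPhiC_*`). The proofs are the direct
three-bit computations behind AJL's "it is easy to verify" (Claim 2.4): on a walk reading
`a, ¬a, c` the middle generator kills one of the two terms of `Φ_i e_p`, and the surviving
coefficients telescope (`λ_{z+1} λ_{z-1} = λ_{z+ε(a)} λ_{z-ε(a)}`); no eigenvector identity is
needed. These relations are the input for cup-sliding (`σ_i σ_{i+1} e_i = d e_{i+1} e_i`) and the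
locality of the encoded braid gates used in the `PromiseBQP`-hardness of the Jones polynomial
(Aharonov–Arad 2011).

No definitions and no new statements of results are introduced; everything is proved.

## References

* D. Aharonov, V. Jones, Z. Landau, Algorithmica 55 (2009) 395–421; arXiv:quant-ph/0511096,
  §2.12 Claim 2.4, §3.1 eq. (3.1) and Claim 3.1 [AharonovJonesLandau2009].
* V. F. R. Jones, *Index for subfactors*, Invent. Math. 72 (1983), §4 (Temperley–Lieb relations
  of the path/AF-algebra projections).
-/

noncomputable section

open Matrix Finset

namespace Literature.Computability.QuantumComplexity

variable {n k : ℕ} {i j : Fin (n - 1)}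

/-! ### Small facts on flips and supports -/

/-- Flipping to the bits a string already has does nothing. [folklore] -/
theorem flipTo_eq_self {p : Cryptography.QReg n} (hc : p (genSnd i) = !p (genFst i)) :
    flipTo p i (p (genFst i)) = p := by
  funext t
  by_cases h1 : t = genFst i
  · subst h1; simp
  · by_cases h2 : t = genSnd i
    · subst h2; rw [flipTo_genSnd, hc]
    · rw [flipTo_of_ne p i _ h1 h2]

/-- Flipping twice at the same generator keeps only the last flip. [folklore] -/
theorem flipTo_flipTo (p : Cryptography.QReg n) (i : Fin (n - 1)) (b b' : Bool) :
    flipTo (flipTo p i b) i b' = flipTo p i b' := by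
  funext t
  by_cases h1 : t = genFst i
  · subst h1; simp
  · by_cases h2 : t = genSnd i
    · subst h2; simp
    · rw [flipTo_of_ne _ i _ h1 h2, flipTo_of_ne _ i _ h1 h2, flipTo_of_ne _ i _ h1 h2]

/-- A flip reads `b, ¬b` at the two bits of the generator. [folklore] -/
theorem flipTo_genSnd_eq_not (p : Cryptography.QReg n) (i : Fin (n - 1)) (b : Bool) :
    flipTo p i b (genSnd i) = !flipTo p i b (genFst i) := by
  simp

/-- A valid walk reading `a, ¬a` at bits `i, i+1` is in the support of its own column.
[cite: AharonovJonesLandau2009, §3.1 eq. (3.1)] -/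
theorem phiSupport_self {p : Cryptography.QReg n} (hp : IsGkPath k n p)
    (hc : p (genSnd i) = !p (genFst i)) : PhiSupport k n i p p := by
  refine ⟨hp, hp, fun _ _ _ => rfl, ?_, ?_⟩ <;> (rw [hc]; cases p (genFst i) <;> simp)

/-- `λ_{z+1} λ_{z-1} = λ_{z+ε(a)} λ_{z+ε(¬a)}` (the two neighbours of `z`, in either order). [folklore] -/
theorem ajlWeight_succ_mul_pred (k : ℕ) (z : ℤ) (a : Bool) :
    ajlWeight k (z + 1) * ajlWeight k (z - 1) =
      ajlWeight k (z + stepSign a) * ajlWeight k (z + stepSign (!a)) := by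
  cases a <;> simp [stepSign, sub_eq_add_neg, mul_comm]

/-! ### Columns of `Φ_i` -/

/-- Columns of a product: `(A B) e_p = A (B e_p)`. [folklore] -/
theorem col_mul {ι : Type*} [Fintype ι] (A B : Matrix ι ι ℝ) (p : ι) :
    (A * B).col p = A *ᵥ B.col p := by
  ext q
  simp [Matrix.mul_apply, Matrix.mulVec, dotProduct]

/-- **Vanishing columns of `Φ_i`**: the column of a string that is not a walk of `P_{n,k}`, or
that reads equal bits at `i, i+1`, is zero (`Φ_i |…00…⟩ = Φ_i |…11…⟩ = 0`, and the zero extension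
off `P_{n,k}`). [cite: AharonovJonesLandau2009, §3.1 eq. (3.1)] -/
theorem col_ajlPhi_eq_zero {p : Cryptography.QReg n}
    (h : ¬ IsGkPath k n p ∨ p (genSnd i) = p (genFst i)) : (ajlPhi k n i).col p = 0 := by
  ext q
  rw [Matrix.col_apply, Pi.zero_apply, ajlPhi_apply, if_neg]
  rintro ⟨hp, -, -, hne, -⟩
  rcases h with h | h
  · exact h hp
  · exact hne h.symm

/-- **The columns of `Φ_i` (AJL eq. (3.1))**: on a walk `p ∈ P_{n,k}` reading `a, ¬a` at bits
`i, i+1`, with `z` the vertex before bit `i`,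
`Φ_i e_p = (λ_{z+ε(a)}/λ_z) e_p + (√(λ_{z+1} λ_{z-1})/λ_z) e_{p♭}`, `p♭ = flipTo p i ¬a`; when
`p♭ ∉ P_{n,k}` the second coefficient is `0` (one of `λ_{z±1}` vanishes).
[cite: AharonovJonesLandau2009, §3.1 eq. (3.1)] -/
theorem col_ajlPhi {p : Cryptography.QReg n} (hp : IsGkPath k n p) (hc : p (genSnd i) = !p (genFst i)) :
    (ajlPhi k n i).col p =
      (ajlWeight k (pathPos p i + stepSign (p (genFst i))) / ajlWeight k (pathPos p i)) •
          Pi.single p (1 : ℝ) +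
        (Real.sqrt (ajlWeight k (pathPos p i + 1) * ajlWeight k (pathPos p i - 1)) /
            ajlWeight k (pathPos p i)) •
          Pi.single (flipTo p i (!p (genFst i))) (1 : ℝ) := by
  set z := pathPos p i with hz
  have hne : flipTo p i (!p (genFst i)) ≠ p := by
    intro h
    have := congr_fun h (genFst i)
    simp at this
  ext q
  simp only [Matrix.col_apply, Pi.add_apply, Pi.smul_apply, smul_eq_mul]
  by_cases h1 : q = p
  · subst h1
    rw [Pi.single_eq_same, Pi.single_eq_of_ne hne.symm, mul_one, mul_zero, add_zero, ajlPhi_apply,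
      if_pos (phiSupport_self hp hc), ← hz, Real.sqrt_mul_self (ajlWeight_nonneg _ _)]
  · by_cases h2 : q = flipTo p i (!p (genFst i))
    · subst h2
      rw [Pi.single_eq_of_ne h1, Pi.single_eq_same, mul_zero, zero_add, mul_one, ajlPhi_apply]
      by_cases hv : IsGkPath k n (flipTo p i (!p (genFst i)))
      · have hs : PhiSupport k n i (flipTo p i (!p (genFst i))) p :=
          ⟨hp, hv, fun t h1 h2 => flipTo_of_ne p i _ h1 h2, by rw [hc]; cases p (genFst i) <;> simp,
            by simp⟩
        rw [if_pos hs, ← hz, flipTo_genFst, ← ajlWeight_succ_mul_pred]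
      · have h0 := ajlWeight_eq_zero_of_not_isGkPath_flipTo hp hc hv
        rw [← hz] at h0
        rw [if_neg (fun h => hv h.2.1), ajlWeight_succ_mul_pred k z (p (genFst i)), h0, mul_zero,
          Real.sqrt_zero, zero_div]
    · rw [Pi.single_eq_of_ne h1, Pi.single_eq_of_ne h2, mul_zero, mul_zero, add_zero]
      cases ha : p (genFst i)
      · refine ajlPhi_apply_eq_zero_of_ne_flipTo ?_ ?_
        · rw [ha] at h2; exact h2
        · rw [← ha, flipTo_eq_self hc]; exact h1
      · refine ajlPhi_apply_eq_zero_of_ne_flipTo ?_ ?_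
        · rw [← ha, flipTo_eq_self hc]; exact h1
        · rw [ha] at h2; exact h2

/-- `Φ_i` applied to a basis vector is its column (restating `col_ajlPhi` with `*ᵥ`). [folklore] -/
theorem ajlPhi_mulVec_single (p : Cryptography.QReg n) :
    ajlPhi k n i *ᵥ Pi.single p 1 = (ajlPhi k n i).col p :=
  Matrix.mulVec_single_one _ _

/-! ### The relation `Φ_i Φ_{i+1} Φ_i = Φ_i` -/

section Adjacent

variable (hij : (j : ℕ) = i + 1)
include hij

/-- Bit `j = i+1` of the right generator is bit `i+1` of the left one. [folklore] -/
theorem genFst_eq_genSnd_of_succ : genFst j = genSnd i := Fin.ext (by simp [hij])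

/-- Bit `j+1 = i+2` is neither bit of the left generator. [folklore] -/
theorem genSnd_succ_ne : genSnd j ≠ genFst i ∧ genSnd j ≠ genSnd i :=
  ⟨fun h => by have := congrArg Fin.val h; simp only [genFst_val, genSnd_val] at this; omega,
    fun h => by have := congrArg Fin.val h; simp only [genSnd_val] at this; omega⟩

/-- Bit `i` is neither bit of the right generator. [folklore] -/
theorem genFst_ne_succ : genFst i ≠ genFst j ∧ genFst i ≠ genSnd j :=
  ⟨fun h => by have := congrArg Fin.val h; simp only [genFst_val] at this; omega,
    fun h => by have := congrArg Fin.val h; simp only [genFst_val, genSnd_val] at this; omega⟩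

/-- The vertex before bit `i+1` is `z + ε(p_i)`. [cite: AharonovJonesLandau2009, Def. 3.2] -/
theorem pathPos_succ_gen (p : Cryptography.QReg n) :
    pathPos p j = pathPos p i + stepSign (p (genFst i)) := by
  have hi : (i : ℕ) < n := by omega
  rw [hij, pathPos_succ p hi]; rfl

/-- Three steps on: a walk reading `a, ¬a, c` at bits `i, i+1, i+2` is at `z + ε(c)` before bit
`i+3`. [cite: AharonovJonesLandau2009, Def. 3.2] -/
theorem pathPos_add_three (p : Cryptography.QReg n) (hc : p (genSnd i) = !p (genFst i)) :
    pathPos p (i + 3) = pathPos p i + stepSign (p (genSnd j)) := by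
  have h0 : (i : ℕ) < n := by omega
  have h1 : (i : ℕ) + 1 < n := by omega
  have h2 : (i : ℕ) + 2 < n := by omega
  rw [show (i : ℕ) + 3 = (i : ℕ) + 2 + 1 by ring, pathPos_succ p h2, pathPos_succ p h1,
    pathPos_succ p h0]
  have e1 : (⟨(i : ℕ) + 1, h1⟩ : Fin n) = genSnd i := rfl
  have e2 : (⟨(i : ℕ) + 2, h2⟩ : Fin n) = genSnd j := Fin.ext (by simp [hij])
  rw [e1, e2, show (⟨(i : ℕ), h0⟩ : Fin n) = genFst i from rfl, hc, stepSign_not]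
  ring

/-- **AJL Claim 3.1: `Φ_i Φ_{i+1} Φ_i = Φ_i`.** On a walk reading `a, ¬a, a` the middle
generator kills the flipped term of `Φ_i e_p` and rescales `e_p` by `λ_z/λ_{z+ε(a)}`, which the
outer `Φ_i` undoes; on `a, ¬a, ¬a` it kills `e_p`, and the flipped term comes back with
`C² λ_z/λ_{z-ε(a)} = λ_{z+ε(a)}/λ_z`. [cite: AharonovJonesLandau2009, Claim 3.1 (Claim 2.4)] -/
theorem ajlPhi_mul_succ_mul : ajlPhi k n i * ajlPhi k n j * ajlPhi k n i = ajlPhi k n i := by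
  refine Matrix.ext_col fun p => ?_
  rw [col_mul, ← mulVec_mulVec]
  by_cases hp : IsGkPath k n p
  swap
  · rw [col_ajlPhi_eq_zero (Or.inl hp), mulVec_zero, mulVec_zero]
  by_cases hc : p (genSnd i) = !p (genFst i)
  swap
  · have hc' : p (genSnd i) = p (genFst i) := by
      cases h : p (genFst i) <;> cases h' : p (genSnd i) <;> simp_all
    rw [col_ajlPhi_eq_zero (Or.inr hc'), mulVec_zero, mulVec_zero]
  -- notation
  set a := p (genFst i) with ha
  set z := pathPos p i with hz
  have hzb : 1 ≤ z ∧ z + 1 ≤ k := hp.bounds (by omega)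
  have hz0 : ajlWeight k z ≠ 0 := (ajlWeight_pos hzb).ne'
  have hpj : pathPos p j = z + stepSign a := pathPos_succ_gen hij p
  have hz1b : 1 ≤ z + stepSign a ∧ z + stepSign a + 1 ≤ k := hpj ▸ hp.bounds (by omega)
  have hz1 : ajlWeight k (z + stepSign a) ≠ 0 := (ajlWeight_pos hz1b).ne'
  have hpj1 : p (genFst j) = !a := by rw [genFst_eq_genSnd_of_succ hij, hc]
  set p' := flipTo p i (!a) with hp'
  have hp'i : p' (genFst i) = !a := flipTo_genFst _ _ _
  have hp'si : p' (genSnd i) = !!a := flipTo_genSnd _ _ _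
  have hp'j : p' (genFst j) = a := by rw [genFst_eq_genSnd_of_succ hij, hp'si, Bool.not_not]
  have hp'sj : p' (genSnd j) = p (genSnd j) :=
    flipTo_of_ne p i _ (genSnd_succ_ne hij).1 (genSnd_succ_ne hij).2
  rw [col_ajlPhi hp hc, mulVec_add, mulVec_smul, mulVec_smul, ajlPhi_mulVec_single,
    ajlPhi_mulVec_single]
  -- case on the third bit
  by_cases h3 : p (genSnd j) = a
  · -- pattern `a, ¬a, a`: `Φ_{i+1}` kills `e_{p'}`, rescales `e_p`
    have hcj : p (genSnd j) = !p (genFst j) := by rw [hpj1, Bool.not_not, h3]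
    have hkill : (ajlPhi k n j).col p' = 0 :=
      col_ajlPhi_eq_zero (Or.inr (by rw [hp'sj, hp'j, h3]))
    rw [hkill, smul_zero, add_zero, col_ajlPhi hp hcj, smul_add, mulVec_add, smul_smul, smul_smul,
      mulVec_smul, mulVec_smul, ajlPhi_mulVec_single, ajlPhi_mulVec_single, col_ajlPhi hp hc]
    -- the flipped term `e_{p̂}`, `p̂ = flipTo p j a`, is killed by the outer `Φ_i`
    have hkill' : (ajlPhi k n i).col (flipTo p j (!p (genFst j))) = 0 := by
      refine col_ajlPhi_eq_zero (Or.inr ?_)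
      rw [← genFst_eq_genSnd_of_succ hij, flipTo_genFst,
        flipTo_of_ne p j _ (genFst_ne_succ hij).1 (genFst_ne_succ hij).2, hpj1, Bool.not_not]
    rw [hkill', smul_zero, add_zero, hpj, hpj1, ← hz, ← ha,
      show z + stepSign a + stepSign (!a) = z by rw [stepSign_not]; ring]
    match_scalars <;> field_simp
  · -- pattern `a, ¬a, ¬a`: `Φ_{i+1}` kills `e_p`, acts on `e_{p'}`
    have h3' : p (genSnd j) = !a := by
      cases h : p (genSnd j) <;> cases h' : a <;> simp_all
    have hkill : (ajlPhi k n j).col p = 0 := col_ajlPhi_eq_zero (Or.inr (by rw [h3', hpj1]))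
    -- `p'` is a walk: its new vertex `z + ε(¬a)` is the vertex of `p` before bit `i+3`
    have hz2b : 1 ≤ z + stepSign (!a) ∧ z + stepSign (!a) + 1 ≤ k := by
      have := hp.bounds (show (i : ℕ) + 3 ≤ n by omega)
      rwa [pathPos_add_three hij p hc, h3'] at this
    have hz2 : ajlWeight k (z + stepSign (!a)) ≠ 0 := (ajlWeight_pos hz2b).ne'
    have hp'v : IsGkPath k n p' := isGkPath_flipTo hp hc (!a) hz2b
    have hc'j : p' (genSnd j) = !p' (genFst j) := by rw [hp'sj, h3', hp'j]
    have hc'i : p' (genSnd i) = !p' (genFst i) := by rw [hp'si, hp'i]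
    have hzp' : pathPos p' i = z := pathPos_flipTo_of_le p i _ le_rfl
    have hzp'j : pathPos p' j = z + stepSign (!a) := by rw [pathPos_succ_gen hij p', hzp', hp'i]
    rw [hkill, smul_zero, zero_add, col_ajlPhi hp'v hc'j, smul_add, mulVec_add, smul_smul, smul_smul,
      mulVec_smul, mulVec_smul, ajlPhi_mulVec_single, ajlPhi_mulVec_single, col_ajlPhi hp'v hc'i]
    -- the flipped term `e_{p̃}`, `p̃ = flipTo p' j ¬a`, is killed by the outer `Φ_i`
    have hkill' : (ajlPhi k n i).col (flipTo p' j (!p' (genFst j))) = 0 := by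
      refine col_ajlPhi_eq_zero (Or.inr ?_)
      rw [← genFst_eq_genSnd_of_succ hij, flipTo_genFst,
        flipTo_of_ne p' j _ (genFst_ne_succ hij).1 (genFst_ne_succ hij).2, hp'j, hp'i]
    rw [hkill', smul_zero, add_zero, hzp'j, hzp', hp'j, hp'i, Bool.not_not, hp', flipTo_flipTo,
      ha, flipTo_eq_self hc, ← ha, ← hz,
      show z + stepSign (!a) + stepSign a = z by rw [stepSign_not]; ring]
    have hsq : Real.sqrt (ajlWeight k (z + 1) * ajlWeight k (z - 1)) *
        Real.sqrt (ajlWeight k (z + 1) * ajlWeight k (z - 1)) =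
          ajlWeight k (z + stepSign a) * ajlWeight k (z + stepSign (!a)) := by
      rw [Real.mul_self_sqrt (mul_nonneg (ajlWeight_nonneg _ _) (ajlWeight_nonneg _ _)),
        ajlWeight_succ_mul_pred k z a]
    match_scalars
    · field_simp
    · field_simp
      linear_combination hsq

/-- **AJL Claim 3.1: `Φ_{i+1} Φ_i Φ_{i+1} = Φ_{i+1}`** (the mirror computation: on a walk reading
`c, b, ¬b` at bits `i, i+1, i+2`, the cases `b = ¬c` and `b = c`).
[cite: AharonovJonesLandau2009, Claim 3.1 (Claim 2.4)] -/
theorem ajlPhi_succ_mul_mul_succ : ajlPhi k n j * ajlPhi k n i * ajlPhi k n j = ajlPhi k n j := by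
  refine Matrix.ext_col fun p => ?_
  rw [col_mul, ← mulVec_mulVec]
  by_cases hp : IsGkPath k n p
  swap
  · rw [col_ajlPhi_eq_zero (Or.inl hp), mulVec_zero, mulVec_zero]
  by_cases hc : p (genSnd j) = !p (genFst j)
  swap
  · have hc' : p (genSnd j) = p (genFst j) := by
      cases h : p (genFst j) <;> cases h' : p (genSnd j) <;> simp_all
    rw [col_ajlPhi_eq_zero (Or.inr hc'), mulVec_zero, mulVec_zero]
  -- notation: bits `c, b, ¬b`
  set c := p (genFst i) with hcdef
  set b := p (genFst j) with hb
  set z := pathPos p i with hz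
  have hzb : 1 ≤ z ∧ z + 1 ≤ k := hp.bounds (by omega)
  have hz0 : ajlWeight k z ≠ 0 := (ajlWeight_pos hzb).ne'
  have hpj : pathPos p j = z + stepSign c := pathPos_succ_gen hij p
  have hz1b : 1 ≤ z + stepSign c ∧ z + stepSign c + 1 ≤ k := hpj ▸ hp.bounds (by omega)
  have hz1 : ajlWeight k (z + stepSign c) ≠ 0 := (ajlWeight_pos hz1b).ne'
  have hpsi : p (genSnd i) = b := by rw [← genFst_eq_genSnd_of_succ hij]
  set p' := flipTo p j (!b) with hp'
  have hp'j : p' (genFst j) = !b := flipTo_genFst _ _ _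
  have hp'sj : p' (genSnd j) = !!b := flipTo_genSnd _ _ _
  have hp'i : p' (genFst i) = c := flipTo_of_ne p j _ (genFst_ne_succ hij).1 (genFst_ne_succ hij).2
  have hp'si : p' (genSnd i) = !b := by rw [← genFst_eq_genSnd_of_succ hij, hp'j]
  have hzp' : pathPos p' i = z := pathPos_flipTo_of_le p j _ (by simp [hij])
  have hzp'j : pathPos p' j = z + stepSign c := by rw [pathPos_succ_gen hij p', hzp', hp'i]
  rw [col_ajlPhi hp hc, mulVec_add, mulVec_smul, mulVec_smul, ajlPhi_mulVec_single,
    ajlPhi_mulVec_single, hpj]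
  by_cases h3 : b = !c
  · -- pattern `c, ¬c, c`: `Φ_i` acts on `e_p`, kills `e_{p'}`
    have hci : p (genSnd i) = !p (genFst i) := by rw [hpsi, h3]
    have hkill : (ajlPhi k n i).col p' = 0 :=
      col_ajlPhi_eq_zero (Or.inr (by rw [hp'si, hp'i, h3, Bool.not_not]))
    rw [hkill, smul_zero, add_zero, col_ajlPhi hp hci, smul_add, mulVec_add, smul_smul, smul_smul,
      mulVec_smul, mulVec_smul, ajlPhi_mulVec_single, ajlPhi_mulVec_single, col_ajlPhi hp hc, hpj]
    have hkill' : (ajlPhi k n j).col (flipTo p i (!p (genFst i))) = 0 := by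
      refine col_ajlPhi_eq_zero (Or.inr ?_)
      rw [genFst_eq_genSnd_of_succ hij, flipTo_genSnd,
        flipTo_of_ne p i _ (genSnd_succ_ne hij).1 (genSnd_succ_ne hij).2, ← hcdef, Bool.not_not,
        hc, h3, Bool.not_not]
    rw [hkill', smul_zero, add_zero, ← hz, ← hcdef, ← hb, h3,
      show z + stepSign c + stepSign (!c) = z by rw [stepSign_not]; ring]
    match_scalars <;> field_simp
  · -- pattern `c, c, ¬c`: `Φ_i` kills `e_p`, acts on `e_{p'}`
    have h3' : b = c := by cases h : b <;> cases h' : c <;> simp_all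
    have hkill : (ajlPhi k n i).col p = 0 := col_ajlPhi_eq_zero (Or.inr (by rw [hpsi, h3']))
    -- `p'` (bits `c, ¬c, c`) is a walk: its new vertex before bit `i+2` is `z`
    have hp'v : IsGkPath k n p' := by
      refine isGkPath_flipTo hp hc (!b) ?_
      rw [hpj, h3', show z + stepSign c + stepSign (!c) = z by rw [stepSign_not]; ring]
      exact hzb
    have hc'i : p' (genSnd i) = !p' (genFst i) := by rw [hp'si, hp'i, h3']
    have hc'j : p' (genSnd j) = !p' (genFst j) := by rw [hp'sj, hp'j]
    rw [hkill, smul_zero, zero_add, col_ajlPhi hp'v hc'i, smul_add, mulVec_add, smul_smul, smul_smul,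
      mulVec_smul, mulVec_smul, ajlPhi_mulVec_single, ajlPhi_mulVec_single, col_ajlPhi hp'v hc'j]
    -- the flipped term `e_{p̃}`, `p̃ = flipTo p' i ¬c`, is killed by the outer `Φ_{i+1}`
    have hkill' : (ajlPhi k n j).col (flipTo p' i (!p' (genFst i))) = 0 := by
      refine col_ajlPhi_eq_zero (Or.inr ?_)
      rw [genFst_eq_genSnd_of_succ hij, flipTo_genSnd,
        flipTo_of_ne p' i _ (genSnd_succ_ne hij).1 (genSnd_succ_ne hij).2, hp'i, Bool.not_not,
        hp'sj, Bool.not_not, h3']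
    rw [hkill', smul_zero, add_zero, hzp'j, hzp', hp'j, hp'i, Bool.not_not, hp', flipTo_flipTo,
      hb, flipTo_eq_self hc, ← hb, h3',
      show z + stepSign c + stepSign (!c) = z by rw [stepSign_not]; ring]
    have hsq : Real.sqrt (ajlWeight k (z + stepSign c + 1) * ajlWeight k (z + stepSign c - 1)) *
        Real.sqrt (ajlWeight k (z + stepSign c + 1) * ajlWeight k (z + stepSign c - 1)) =
          ajlWeight k (z + stepSign c + stepSign c) * ajlWeight k z := by
      rw [Real.mul_self_sqrt (mul_nonneg (ajlWeight_nonneg _ _) (ajlWeight_nonneg _ _)),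
        ajlWeight_succ_mul_pred k (z + stepSign c) c,
        show z + stepSign c + stepSign (!c) = z by rw [stepSign_not]; ring]
    match_scalars
    · field_simp
    · field_simp
      linear_combination hsq

end Adjacent

/-! ### Far commutativity `Φ_i Φ_j = Φ_j Φ_i`, `j ≥ i + 2` -/

section Far

variable (hij : (i : ℕ) + 2 ≤ j)
include hij

/-- The bits of `Φ_j` are off the bits of `Φ_i` when `j ≥ i + 2`. [folklore] -/
theorem gen_ne_of_le :
    (genFst j ≠ genFst i ∧ genFst j ≠ genSnd i) ∧ (genSnd j ≠ genFst i ∧ genSnd j ≠ genSnd i) ∧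
      (genFst i ≠ genFst j ∧ genFst i ≠ genSnd j) ∧ (genSnd i ≠ genFst j ∧ genSnd i ≠ genSnd j) := by
  refine ⟨⟨?_, ?_⟩, ⟨?_, ?_⟩, ⟨?_, ?_⟩, ⟨?_, ?_⟩⟩ <;>
    exact fun h => by have := congrArg Fin.val h; simp at this; omega

/-- Flips at `i` and at `j ≥ i + 2` commute. [folklore] -/
theorem flipTo_flipTo_comm (p : Cryptography.QReg n) (b c : Bool) :
    flipTo (flipTo p i b) j c = flipTo (flipTo p j c) i b := by
  obtain ⟨⟨h1, h2⟩, ⟨h3, h4⟩, ⟨h5, h6⟩, ⟨h7, h8⟩⟩ := gen_ne_of_le hij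
  funext t
  by_cases t1 : t = genFst i
  · subst t1; rw [flipTo_genFst, flipTo_of_ne _ j _ h5 h6, flipTo_genFst]
  by_cases t2 : t = genSnd i
  · subst t2; rw [flipTo_genSnd, flipTo_of_ne _ j _ h7 h8, flipTo_genSnd]
  by_cases t3 : t = genFst j
  · subst t3; rw [flipTo_genFst, flipTo_of_ne _ i _ t1 t2, flipTo_genFst]
  by_cases t4 : t = genSnd j
  · subst t4; rw [flipTo_genSnd, flipTo_of_ne _ i _ t1 t2, flipTo_genSnd]
  rw [flipTo_of_ne _ j _ t3 t4, flipTo_of_ne _ i _ t1 t2, flipTo_of_ne _ i _ t1 t2,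
    flipTo_of_ne _ j _ t3 t4]

/-- The column of `Φ_i Φ_j` at a walk, `j ≥ i + 2`: both generators act on their own bits with
their own (unchanged) vertices. [cite: AharonovJonesLandau2009, Claim 3.1] -/
theorem col_ajlPhi_mul_ajlPhi_far {p : Cryptography.QReg n} (hp : IsGkPath k n p)
    (hci : p (genSnd i) = !p (genFst i)) (hcj : p (genSnd j) = !p (genFst j)) :
    (ajlPhi k n i * ajlPhi k n j).col p =
      ((ajlWeight k (pathPos p i + stepSign (p (genFst i))) / ajlWeight k (pathPos p i)) *
          (ajlWeight k (pathPos p j + stepSign (p (genFst j))) / ajlWeight k (pathPos p j))) •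
          Pi.single p (1 : ℝ) +
      ((Real.sqrt (ajlWeight k (pathPos p i + 1) * ajlWeight k (pathPos p i - 1)) /
            ajlWeight k (pathPos p i)) *
          (ajlWeight k (pathPos p j + stepSign (p (genFst j))) / ajlWeight k (pathPos p j))) •
          Pi.single (flipTo p i (!p (genFst i))) (1 : ℝ) +
      ((ajlWeight k (pathPos p i + stepSign (p (genFst i))) / ajlWeight k (pathPos p i)) *
          (Real.sqrt (ajlWeight k (pathPos p j + 1) * ajlWeight k (pathPos p j - 1)) /
            ajlWeight k (pathPos p j))) •
          Pi.single (flipTo p j (!p (genFst j))) (1 : ℝ) +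
      ((Real.sqrt (ajlWeight k (pathPos p i + 1) * ajlWeight k (pathPos p i - 1)) /
            ajlWeight k (pathPos p i)) *
          (Real.sqrt (ajlWeight k (pathPos p j + 1) * ajlWeight k (pathPos p j - 1)) /
            ajlWeight k (pathPos p j))) •
          Pi.single (flipTo (flipTo p j (!p (genFst j))) i (!p (genFst i))) (1 : ℝ) := by
  obtain ⟨⟨h1, h2⟩, ⟨h3, h4⟩, ⟨h5, h6⟩, ⟨h7, h8⟩⟩ := gen_ne_of_le hij
  set q := flipTo p j (!p (genFst j)) with hq
  have hqi : q (genFst i) = p (genFst i) := flipTo_of_ne p j _ h5 h6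
  have hqsi : q (genSnd i) = !q (genFst i) := by
    rw [hqi]; show flipTo p j _ (genSnd i) = _; rw [flipTo_of_ne p j _ h7 h8, hci]
  have hzq : pathPos q i = pathPos p i := pathPos_flipTo_of_le p j _ (by omega)
  rw [col_mul, col_ajlPhi hp hcj, mulVec_add, mulVec_smul, mulVec_smul, ajlPhi_mulVec_single,
    ajlPhi_mulVec_single, col_ajlPhi hp hci]
  by_cases hqv : IsGkPath k n q
  · rw [col_ajlPhi hqv hqsi, hzq, hqi]
    module
  · -- the flip at `j` is not a walk: its coefficient vanishes and so does its column
    have h0 : Real.sqrt (ajlWeight k (pathPos p j + 1) * ajlWeight k (pathPos p j - 1)) = 0 := by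
      rw [ajlWeight_succ_mul_pred k _ (p (genFst j)),
        ajlWeight_eq_zero_of_not_isGkPath_flipTo hp hcj hqv, mul_zero, Real.sqrt_zero]
    rw [col_ajlPhi_eq_zero (Or.inl hqv), h0]
    simp only [smul_zero, add_zero, zero_div, mul_zero, zero_smul]
    module

/-- **AJL Claim 3.1: far commutativity `Φ_i Φ_j = Φ_j Φ_i` for `j ≥ i + 2`.**
[cite: AharonovJonesLandau2009, Claim 3.1 (Claim 2.4)] -/
theorem ajlPhi_mul_comm_of_le : ajlPhi k n i * ajlPhi k n j = ajlPhi k n j * ajlPhi k n i := by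
  obtain ⟨⟨h1, h2⟩, ⟨h3, h4⟩, ⟨h5, h6⟩, ⟨h7, h8⟩⟩ := gen_ne_of_le hij
  refine Matrix.ext_col fun p => ?_
  by_cases hp : IsGkPath k n p
  swap
  · rw [col_mul, col_mul, col_ajlPhi_eq_zero (Or.inl hp), col_ajlPhi_eq_zero (Or.inl hp),
      mulVec_zero, mulVec_zero]
  by_cases hci : p (genSnd i) = !p (genFst i)
  swap
  · have hci' : p (genSnd i) = p (genFst i) := by
      cases h : p (genFst i) <;> cases h' : p (genSnd i) <;> simp_all
    rw [col_mul, col_mul, col_ajlPhi_eq_zero (Or.inr hci'), mulVec_zero]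
    by_cases hcj : p (genSnd j) = !p (genFst j)
    · rw [col_ajlPhi hp hcj, mulVec_add, mulVec_smul, mulVec_smul, ajlPhi_mulVec_single,
        ajlPhi_mulVec_single, col_ajlPhi_eq_zero (Or.inr hci'), col_ajlPhi_eq_zero (Or.inr _),
        smul_zero, smul_zero, add_zero]
      rw [flipTo_of_ne p j _ h7 h8, flipTo_of_ne p j _ h5 h6, hci']
    · have hcj' : p (genSnd j) = p (genFst j) := by
        cases h : p (genFst j) <;> cases h' : p (genSnd j) <;> simp_all
      rw [col_ajlPhi_eq_zero (Or.inr hcj'), mulVec_zero]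
  by_cases hcj : p (genSnd j) = !p (genFst j)
  swap
  · have hcj' : p (genSnd j) = p (genFst j) := by
      cases h : p (genFst j) <;> cases h' : p (genSnd j) <;> simp_all
    rw [col_mul, col_mul, col_ajlPhi_eq_zero (Or.inr hcj'), mulVec_zero, col_ajlPhi hp hci,
      mulVec_add, mulVec_smul, mulVec_smul, ajlPhi_mulVec_single, ajlPhi_mulVec_single,
      col_ajlPhi_eq_zero (Or.inr hcj'), col_ajlPhi_eq_zero (Or.inr _), smul_zero, smul_zero,
      add_zero]
    rw [flipTo_of_ne p i _ h3 h4, flipTo_of_ne p i _ h1 h2, hcj']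
  -- the generic case: both act
  rw [col_ajlPhi_mul_ajlPhi_far hij hp hci hcj]
  -- expand the right-hand side the same way, with the roles of `i` and `j` exchanged by hand
  set q := flipTo p i (!p (genFst i)) with hq
  have hqj : q (genFst j) = p (genFst j) := flipTo_of_ne p i _ h1 h2
  have hqsj : q (genSnd j) = !q (genFst j) := by
    rw [hqj]; show flipTo p i _ (genSnd j) = _; rw [flipTo_of_ne p i _ h3 h4, hcj]
  have hzq : pathPos q j = pathPos p j := pathPos_flipTo_of_ge p i _ hci hij
  rw [col_mul, col_ajlPhi hp hci, mulVec_add, mulVec_smul, mulVec_smul, ajlPhi_mulVec_single,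
    ajlPhi_mulVec_single, col_ajlPhi hp hcj]
  by_cases hqv : IsGkPath k n q
  · rw [col_ajlPhi hqv hqsj, hzq, hqj, hq, flipTo_flipTo_comm hij]
    module
  · have h0 : Real.sqrt (ajlWeight k (pathPos p i + 1) * ajlWeight k (pathPos p i - 1)) = 0 := by
      rw [ajlWeight_succ_mul_pred k _ (p (genFst i)),
        ajlWeight_eq_zero_of_not_isGkPath_flipTo hp hci hqv, mul_zero, Real.sqrt_zero]
    rw [col_ajlPhi_eq_zero (Or.inl hqv), h0]
    simp only [smul_zero, add_zero, zero_div, zero_mul, zero_smul]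
    module

end Far

/-! ### Complex forms -/

/-- Entrywise real-to-complex coercion is multiplicative on matrices. [folklore] -/
theorem map_ofReal_mul {ι : Type*} [Fintype ι] (A B : Matrix ι ι ℝ) :
    (A * B).map ((↑) : ℝ → ℂ) = A.map ((↑) : ℝ → ℂ) * B.map ((↑) : ℝ → ℂ) := by
  ext q p
  simp only [Matrix.map_apply, Matrix.mul_apply]
  push_cast
  rfl

/-- `Φ_i Φ_{i+1} Φ_i = Φ_i` over `ℂ`. [cite: AharonovJonesLandau2009, Claim 3.1] -/
theorem ajlPhiC_mul_succ_mul (hij : (j : ℕ) = i + 1) :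
    ajlPhiC k n i * ajlPhiC k n j * ajlPhiC k n i = ajlPhiC k n i := by
  change (ajlPhi k n i).map _ * (ajlPhi k n j).map _ * (ajlPhi k n i).map _ = (ajlPhi k n i).map _
  rw [← map_ofReal_mul, ← map_ofReal_mul, ajlPhi_mul_succ_mul hij]

/-- `Φ_{i+1} Φ_i Φ_{i+1} = Φ_{i+1}` over `ℂ`. [cite: AharonovJonesLandau2009, Claim 3.1] -/
theorem ajlPhiC_succ_mul_mul_succ (hij : (j : ℕ) = i + 1) :
    ajlPhiC k n j * ajlPhiC k n i * ajlPhiC k n j = ajlPhiC k n j := by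
  change (ajlPhi k n j).map _ * (ajlPhi k n i).map _ * (ajlPhi k n j).map _ = (ajlPhi k n j).map _
  rw [← map_ofReal_mul, ← map_ofReal_mul, ajlPhi_succ_mul_mul_succ hij]

/-- `Φ_i Φ_j = Φ_j Φ_i` over `ℂ` for `j ≥ i + 2`. [cite: AharonovJonesLandau2009, Claim 3.1] -/
theorem ajlPhiC_mul_comm_of_le (hij : (i : ℕ) + 2 ≤ j) :
    ajlPhiC k n i * ajlPhiC k n j = ajlPhiC k n j * ajlPhiC k n i := by
  change (ajlPhi k n i).map _ * (ajlPhi k n j).map _ = (ajlPhi k n j).map _ * (ajlPhi k n i).map _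
  rw [← map_ofReal_mul, ← map_ofReal_mul, ajlPhi_mul_comm_of_le hij]

end Literature.Computability.QuantumComplexity

end
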